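import Literature.RingTheory.CohomologyAnnihilator.StableAnnihilation
import Literature.RingTheory.CohomologyAnnihilator.TowerBasic
import HarnessLib

/-!
# Crux `NoZenoR` (stmt-ResolutionOfSingularities-19943), T_ST / THEOREM 22.5 — the STABLE ANNIHILATOR OF AN IDEAL:
# `tr(I) + ann(I)` kills `Ext^{≥1}(I, −)`, and conversely for a factorisation through a finite free module

Route `ResolutionOfSingularities/HomologicalConductor`, chain W4.4, KERNEL-g22 §4″ (lead g22). `[OURS]` — AI-formalised,
weaker than expert review; NOT a statement of any manuscript under review.

For an ideal `I` of a commutative ring `R` write `tr(I) = ⨆_{φ ∈ I^*} range φ` (no definition introduced, as in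
`Literature/RingTheory/CohomologyAnnihilator/TraceIdealBound`). The tree vendors Dey's inclusion «`c • 𝟙_I` factors through
a free module ⇒ `c ∈ tr(I)`» for non-zero ideals of a DOMAIN. Here, for ideals of an ARBITRARY commutative ring:

* `comp_eq_smul_id_of_dual` — for `φ ∈ I^*`, `a ∈ I` the composite `I —φ→ R —(·a)→ I` is `φ(a) • 𝟙_I`
  (`φ(x) a = x φ(a)` since both equal `φ(x a)`);
* `smul_ext_ideal_eq_zero_of_mem_iSup_range_dual` — every `c ∈ tr(I)` kills `Extⁱ(I, N)` for all `N`, `i ≥ 1`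
  (the set of such `c` is an ideal, and each `φ(a)` is in it by the factorisation through the free module `R`);
* `smul_ext_ideal_eq_zero_of_mem_annihilator`, `smul_ext_ideal_eq_zero_of_mem_sup` — the same for `ann(I)` and for
  `tr(I) ⊔ ann(I)`;
* `mem_iSup_range_dual_sup_annihilator_of_comp_eq_smul` — conversely, if `c • 𝟙_I` factors `I → Rⁿ → I` through a
  FINITE free module then `c ∈ tr(I) ⊔ ann(I)` (no domain hypothesis: `c x = x·Σᵢ φᵢ(aᵢ)` for all `x ∈ I`).

So for a finitely generated ideal the stable annihilator `𝔰(I) = {c : c • 𝟙_I factors through a free module}` equals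
`tr(I) + ann(I)` (= `tr(I)` if `I` contains a non-zero-divisor). Use: KERNEL-g22 THEOREM 22.5 ((ST) fails for ⅟8(1,5))
computes `caⁿ` of cyclic quotient surfaces from `𝔰(M_j) = tr(M_j) = M_j·M_{−j}` for the rank-one reflexives `M_j ≅` ideals.
-/

noncomputable section

-- single-problem summit: the doubled namespace component is forced
set_option linter.dupNamespace false

open CategoryTheory CategoryTheory.Abelian CategoryTheory.Limits
open Literature.RingTheory.CohomologyAnnihilator

universe u

namespace Summit.ResolutionOfSingularities.ResolutionOfSingularities.Theorems.NoZeno.TraceStable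

variable {R : Type u} [CommRing R] (I : Ideal R)

/-- Key commutation inside an ideal: `φ(x) · a = x · φ(a)` for `φ ∈ I^*`, `x, a ∈ I` (both are `φ(x a)`). [folklore] -/
theorem dual_apply_mul_comm (φ : Module.Dual R I) (x a : I) : φ x * (a : R) = (x : R) * φ a := by
  have h1 : ((a : R) • x : I) = ((x : R) • a : I) := by
    apply Subtype.ext
    simp [mul_comm]
  have h2 : φ ((a : R) • x) = (a : R) * φ x := by rw [map_smul, smul_eq_mul]
  have h3 : φ ((x : R) • a) = (x : R) * φ a := by rw [map_smul, smul_eq_mul]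
  rw [mul_comm, ← h2, h1, h3]

/-- For `φ ∈ I^*` and `a ∈ I`, the composite `I —φ→ R —(r ↦ r a)→ I` is the homothety `φ(a) • 𝟙_I`. [folklore] -/
theorem comp_eq_smul_id_of_dual (φ : Module.Dual R I) (a : I) :
    ModuleCat.ofHom (X := ModuleCat.of R I) (Y := ModuleCat.of R R) φ ≫
        ModuleCat.ofHom (LinearMap.toSpanSingleton R I a) =
      φ a • 𝟙 (ModuleCat.of R I) := by
  apply ModuleCat.hom_ext
  apply LinearMap.ext
  intro x
  apply Subtype.ext
  change ((φ x) • a : I).1 = ((φ a) • x : I).1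
  simp only [SetLike.val_smul, smul_eq_mul]
  rw [dual_apply_mul_comm]
  ring

/-- **`tr(I)` kills positive `Ext`.** If `c ∈ tr(I) = ⨆_{φ ∈ I^*} range φ` then `c • Extⁱ(I, N) = 0` for every `R`-module
`N` and every `i ≥ 1` — each `φ(a)•𝟙_I` factors through the free module `R`, and the annihilating elements form an ideal.
[this work; converse direction of Dey2022TraceIdeal Thm. 1.1 for ideals, no domain hypothesis] -/
theorem smul_ext_ideal_eq_zero_of_mem_iSup_range_dual {c : R}
    (hc : c ∈ ⨆ φ : Module.Dual R I, LinearMap.range φ) (N : ModuleCat.{u} R) {i : ℕ} (hi : 1 ≤ i)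
    (e : Ext.{u} (ModuleCat.of R I) N i) : c • e = 0 := by
  -- the annihilating elements form an ideal `A`
  let A : Ideal R :=
    { carrier := {c | ∀ (N : ModuleCat.{u} R) (i : ℕ), 1 ≤ i → ∀ e : Ext.{u} (ModuleCat.of R I) N i, c • e = 0}
      add_mem' := fun {a b} ha hb N i hi e => by rw [add_smul, ha N i hi e, hb N i hi e, add_zero]
      zero_mem' := fun N i hi e => zero_smul R e
      smul_mem' := fun r {a} ha N i hi e => by rw [smul_eq_mul, mul_smul, ha N i hi e, smul_zero] }
  have hle : (⨆ φ : Module.Dual R I, LinearMap.range φ) ≤ A := by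
    refine iSup_le fun φ => ?_
    rintro _ ⟨a, rfl⟩ N' i' hi' e'
    haveI : Projective (ModuleCat.of R R) := (IsProjective.iff_projective (R := R) R).mp inferInstance
    exact smul_ext_eq_zero_of_comp_eq_smul_id _ _ (comp_eq_smul_id_of_dual I φ a) hi' e'
  exact hle hc N i hi e

/-- `ann(I)` kills positive `Ext` of `I` (the homothety is zero, so it factors through `R` trivially). [folklore] -/
theorem smul_ext_ideal_eq_zero_of_mem_annihilator {c : R} (hc : c ∈ Module.annihilator R I)
    (N : ModuleCat.{u} R) {i : ℕ} (hi : 1 ≤ i) (e : Ext.{u} (ModuleCat.of R I) N i) : c • e = 0 := by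
  haveI : Projective (ModuleCat.of R R) := (IsProjective.iff_projective (R := R) R).mp inferInstance
  refine smul_ext_eq_zero_of_comp_eq_smul_id (0 : ModuleCat.of R I ⟶ ModuleCat.of R R) 0 ?_ hi e
  rw [zero_comp]
  apply ModuleCat.hom_ext
  apply LinearMap.ext
  intro x
  change (0 : I) = c • x
  exact (Module.mem_annihilator.mp hc x).symm

/-- `tr(I) + ann(I)` kills positive `Ext` of `I`. [this work] -/
theorem smul_ext_ideal_eq_zero_of_mem_sup {c : R}
    (hc : c ∈ (⨆ φ : Module.Dual R I, LinearMap.range φ) ⊔ Module.annihilator R I)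
    (N : ModuleCat.{u} R) {i : ℕ} (hi : 1 ≤ i) (e : Ext.{u} (ModuleCat.of R I) N i) : c • e = 0 := by
  obtain ⟨t, ht, z, hz, rfl⟩ := Submodule.mem_sup.mp hc
  rw [add_smul, smul_ext_ideal_eq_zero_of_mem_iSup_range_dual I ht N hi e,
    smul_ext_ideal_eq_zero_of_mem_annihilator I hz N hi e, add_zero]

/-- **Converse, without a domain hypothesis.** If `c • 𝟙_I` factors `I —f→ Rⁿ —g→ I` through a FINITE free module then
`c ∈ tr(I) + ann(I)`: with `φᵢ = prᵢ ∘ f`, `aᵢ = g(eᵢ)` one has `c x = Σᵢ φᵢ(x) aᵢ = x Σᵢ φᵢ(aᵢ)` for all `x ∈ I`.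
[this work; cf. Dey2022TraceIdeal Thm. 1.1 (domains)] -/
theorem mem_iSup_range_dual_sup_annihilator_of_comp_eq_smul {n : ℕ} (f : I →ₗ[R] (Fin n → R))
    (g : (Fin n → R) →ₗ[R] I) {c : R} (h : ∀ x : I, g (f x) = c • x) :
    c ∈ (⨆ φ : Module.Dual R I, LinearMap.range φ) ⊔ Module.annihilator R I := by
  classical
  let φ : Fin n → Module.Dual R I := fun i => (LinearMap.proj i) ∘ₗ f
  let a : Fin n → I := fun i => g (Pi.single i 1)
  set t : R := ∑ i, φ i (a i) with ht
  have htr : t ∈ ⨆ ψ : Module.Dual R I, LinearMap.range ψ :=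
    Submodule.sum_mem _ fun i _ =>
      (le_iSup (fun ψ : Module.Dual R I => LinearMap.range ψ) (φ i)) (LinearMap.mem_range_self _ _)
  -- `c x = x t` for every `x ∈ I`
  have key : ∀ x : I, c * (x : R) = (x : R) * t := by
    intro x
    have hfx : f x = ∑ i, (f x i) • (Pi.single i 1 : Fin n → R) := by
      ext j
      simp [Finset.sum_apply, Pi.single_apply]
    have H := h x
    rw [hfx, map_sum] at H
    simp_rw [map_smul] at H
    have H' := congrArg (fun y : I => (y : R)) H
    simp only [AddSubmonoidClass.coe_finsetSum, SetLike.val_smul, smul_eq_mul] at H'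
    rw [← H', ht, Finset.mul_sum]
    refine Finset.sum_congr rfl fun i _ => ?_
    exact dual_apply_mul_comm I (φ i) x (a i)
  have hz : c - t ∈ Module.annihilator R I := by
    rw [Module.mem_annihilator]
    intro x
    apply Subtype.ext
    change (c - t) * (x : R) = 0
    rw [sub_mul, key x, mul_comm, sub_self]
  have : c = t + (c - t) := by ring
  rw [this]
  exact Submodule.add_mem_sup htr hz

end Summit.ResolutionOfSingularities.ResolutionOfSingularities.Theorems.NoZeno.TraceStable
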